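import Mathlib

/-!
# Hodge-locus census (cell `pub-hlocus`, engine B, abs-2 gen 49) — combinatorial core of the WALL LAW (§64.10–64.11)

certified instances and evidence bearing on the general Hodge conjecture; no claim.

Helper file of `stmt-HodgeConjecture-16267` (computational census records; nothing here is
used by any route).  Registered in `ABSHODGE.md` LOG 2026-08-23T12:44:18Z (before the W4
production rows); derivation `data/abs/engineB/DERIVATIONS_engineB.md` §64.10–64.13.

* `two_mul_card_eq_of_involution_swaps` — the EXACT HALF of the wall law: if a fixed-point-free
  involution `σ` of a finite type maps a set `A` onto its complement, then `2·#A = #X`.  In the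
  census `X = {𝔟 ∈ Cl(D′) : ω(𝔟) = k}`, `σ = [𝔭₃′]` (flips the leading `π`-adic digit, §64.10a:
  144 176 values checked, 0 exceptions) and `A = {𝔟 : e(𝔞, 𝔟) = k − 1}`.
* `haar_mixture_of_HEQ2` — the registered ζ₃ Haar cell probabilities
  `π = (1/3, 1/3, 1/9, 2/27, 7/81, 7/243, 8/243)` for the cells `S = 3,4,5,6,7,8,≥9` are exactly
  the mixture of the re-based null H-EQ″ over the Haar strata masses
  `(1,1) ↦ 1/2, (2,2) ↦ 2/9, (2,>2) ↦ 2/9, (3,3) ↦ d, (3,>3) ↦ f, deeper ↦ g` with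
  `d/2 + f = 1/27`, `d/2 + g = 1/54`, `d + f + g = 1/18` (§64.11) — checked here as rational
  identities for every cell.
-/

set_option linter.dupNamespace false

namespace Summit.HodgeConjecture.HodgeConjecture.HodgeLocus.Census.WallLawB

open Finset

/-- EXACT HALF (§64.10): a fixed-point-free involution that maps `A` onto its complement forces
`2 · #A = #X`. -/
theorem two_mul_card_eq_of_involution_swaps {X : Type*} [Fintype X] [DecidableEq X]
    (σ : X → X) (hσ : ∀ x, σ (σ x) = x) (A : Finset X)
    (hswap : ∀ x, x ∈ A ↔ σ x ∉ A) : 2 * A.card = Fintype.card X := by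
  classical
  -- σ restricts to a bijection A → Aᶜ
  have himage : A.image σ = Aᶜ := by
    ext y
    simp only [mem_image, mem_compl]
    constructor
    · rintro ⟨x, hx, rfl⟩
      exact (hswap x).1 hx
    · intro hy
      refine ⟨σ y, ?_, hσ y⟩
      have := (hswap (σ y))
      rw [hσ y] at this
      by_contra h
      exact hy (by
        by_contra h'
        exact h (by
          have h2 := (hswap (σ y)).2
          rw [hσ y] at h2
          exact h2 h'))
  have hinj : Set.InjOn σ ↑A := by
    intro x _ y _ hxy
    have := congrArg σ hxy
    rwa [hσ x, hσ y] at this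
  have hcard : (A.image σ).card = A.card := card_image_of_injOn hinj
  have := A.card_add_card_compl
  rw [← himage, hcard] at this
  omega

/-- H-EQ″ ⇒ registered π (§64.11), cell `S = 3`: `(2/9)·(1/2) + (2/9)·1 = 1/3`. -/
theorem haar_mixture_cell3 : (2 / 9 : ℚ) * (1 / 2) + (2 / 9) * 1 = 1 / 3 := by norm_num
/-- cell `S = 4`: `(1/2)·(2/3) = 1/3`. -/
theorem haar_mixture_cell4 : (1 / 2 : ℚ) * (2 / 3) = 1 / 3 := by norm_num
/-- cell `S = 5`: `(1/2)·(2/9) = 1/9`. -/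
theorem haar_mixture_cell5 : (1 / 2 : ℚ) * (2 / 9) = 1 / 9 := by norm_num
/-- cell `S = 7`: `(1/2)·(2/81) + (2/9)·(1/3) = 7/81`. -/
theorem haar_mixture_cell7 : (1 / 2 : ℚ) * (2 / 81) + (2 / 9) * (1 / 3) = 7 / 81 := by norm_num
/-- cell `S = 8`: `(1/2)·(2/243) + (2/9)·(1/9) = 7/243`. -/
theorem haar_mixture_cell8 : (1 / 2 : ℚ) * (2 / 243) + (2 / 9) * (1 / 9) = 7 / 243 := by norm_num
/-- cells `S = 6` and `S ≥ 9` and the total mass: with the deeper strata masses `d, f, g`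
(`(3,3)`, `(3,>3)`, `≥ 4`) the three remaining equations are consistent and determine
`d/2 + f = 1/27`, `d/2 + g = 1/54`, hence `d + f + g = 1/18 = 1 − 1/2 − 2/9 − 2/9`. -/
theorem haar_mixture_of_HEQ2 (d f g : ℚ)
    (h6 : (1 / 2 : ℚ) * (2 / 27) + d * (1 / 2) + f * 1 = 2 / 27)
    (h9 : (1 / 2 : ℚ) * (1 / 243) + (2 / 9) * (1 / 18) + d * (1 / 2) + g * 1 = 8 / 243) :
    d / 2 + f = 1 / 27 ∧ d / 2 + g = 1 / 54 ∧ (1 / 2 : ℚ) + 2 / 9 + 2 / 9 + (d + f + g) = 1 := by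
  refine ⟨by linarith, by linarith, by linarith⟩

end Summit.HodgeConjecture.HodgeConjecture.HodgeLocus.Census.WallLawB
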